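import Summits.Langlands.Langlands.Theses.ClassicalCongruenceSplit

/-!
# Route ClassicalCongruenceSplit — Assembly

The assembly item (stmt-Langlands-27277) of the child route `ClassicalCongruenceSplit` (decomp-langlands lens-4 gen 20; a gate-native D-0170
refining child: `--refines route-Langlands-GenuineTorsionSplit:GenuineTorsionAutomorphy`, edge split, depth 1, no FRAME item) for the crux
`GenuineTorsionSplit.GenuineTorsionAutomorphy` (stmt-Langlands-27089):
`DyadicTowerClassicalRelations → ClassicalCongruenceJunction → WeightedLiftableAutomorphy → GenuineTorsionSplit.GenuineTorsionAutomorphy`.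

This is literally the type of the route file's sorry-free deciding theorem `Summit.Langlands.Langlands.Theses.ClassicalCongruenceSplit.closes`
(torsion classicality modulo nilpotence at p = 2 + a classical congruence junction + the weighted liftable avatar).  Nothing here proves `Langlands` (nor the parent crux): the assembly records only that the ledger items of the
route, taken together, imply the refined crux.
-/

set_option linter.dupNamespace false -- project-wide option (lakefile weak.linter.dupNamespace); `Summit.Langlands.Langlands` is the mandated namespace

namespace Summit.Langlands.Langlands.Theorems

/-- **Assembly of route ClassicalCongruenceSplit** (stmt-Langlands-27277): `S2T → CJ → WL → GenuineTorsionSplit.GenuineTorsionAutomorphy`.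
Proof: unfold `Assembly` and apply the route's deciding theorem `Theses.ClassicalCongruenceSplit.closes`. -/
theorem classicalCongruenceSplit_assembly_proof :
    Summit.Langlands.Langlands.Theses.ClassicalCongruenceSplit.Assembly := by
  unfold Summit.Langlands.Langlands.Theses.ClassicalCongruenceSplit.Assembly
  exact Summit.Langlands.Langlands.Theses.ClassicalCongruenceSplit.closes

end Summit.Langlands.Langlands.Theorems
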